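import Mathlib
import Summits.AtomisticToContinuum.Crystallization.Theses.HullExactificationCascade
import Summits.AtomisticToContinuum.Crystallization.Theses.HcpDefectCounting
import Summits.AtomisticToContinuum.Crystallization.Theorems.HullExactificationCascadeHcpLandscapeGapOfHcpDefectCounting
import Summits.AtomisticToContinuum.Crystallization.Theorems.PricedLinkCensusStackingHingeLjRegistryDomination
import Summits.AtomisticToContinuum.Crystallization.Theorems.PricedLinkCensusStackingHingeBarlowEnergyIdentification
import Summits.AtomisticToContinuum.Crystallization.Theorems.PricedLinkCensusStackingHingeHcpEnergyMinOnBox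
import Summits.AtomisticToContinuum.Crystallization.Theorems.MinMeanCycleStackingLockHaggEnergyPeriodic

/-!
# Crux `HcpLandscapeGap` (route HullExactificationCascade, item stmt-AtomisticToContinuum-12087) —
# the reduction of skeleton v4: `(R) → (S) → HcpDefectCoercivity → HcpLandscapeGap`

Skeleton v3 (lead c3) landed `HcpLandscapeGap_of_hcpDefectCounting : HcpBulkFloor → HcpDefectCoercivity →
HcpLandscapeGap` (p149126).  Skeleton v4 (lead c4) cuts the first hypothesis, the sibling crux
`HcpDefectCounting.HcpBulkFloor` (stmt-14477), one level deeper along the cut registered for it in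
`Cruxes/HcpBulkFloor/Lines/birth.lean` (planner-skel-stmt-AtomisticToContinuum-14477-0), whose glue is
re-proved here in this line's namespace so that it can be imported by Theorems files:

* `hcpPeriodicMinimiser_of_stubs : (R) → (S) → HcpDefectCounting.HcpPeriodicMinimiser` — for a periodic
  competitor `Q`, (R) gives a uniform box Barlow stacking below `Q`; the LANDED certified registry
  numerics (item 3063, `stub_ljRegistryDomination`: `J₂ < 0`, `Σ_{k≥3}(k−1)|J_k| ≤ |J₂|/2`) feed (S) with
  `J = barlowCoupling lennardJones a h`; the landed periodic averaging `tendsto_haggEnergy_div`,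
  `haggStackingEnergy_alternating` and the LANDED layer identification (item 3065,
  `stub_barlowEnergyIdentification`) turn `h(J, alt) ≤ h(J, s)` into `e(hcp a h) ≤ e(barlow a h s)`;
  the LANDED box minimiser (item 3066, `stub_hcpEnergyMinOnBox`) closes the chain
  `e(hcp a₀ h₀) ≤ e(hcp a h) ≤ e(barlow a h s) ≤ e(Q)`;
* `hcpBulkFloor_of_hcpPeriodicMinimiser : HcpPeriodicMinimiser → HcpBulkFloor` — the landed
  finite-to-periodic floor `ChargedEnergyGapNegative.card_mul_eStar_le` (`N·e* ≤ 𝓔_LJ(x)`, `e* = ⨅_Q e(Q)`)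
  and `IsLeast.csInf_eq`;
* `HcpLandscapeGap_of_periodicReduction : (R) → (S) → HcpDefectCoercivity → HcpLandscapeGap`.

Here (R) is VERBATIM the shared crux `PoissonBesselStacking.PeriodicReductionToBarlow` (item 3062) and
(S) VERBATIM the support item `OneCrossingRisingSea.DominatedRegistrySelectsHcp` (item 12054) = stub (S)
of this line (landed separately as `stub_dominatedRegistrySelectsHcp`).
-/

namespace Summit.AtomisticToContinuum.Crystallization.Theorems.HcpLandscapeGapBirth

open Literature.MathematicalPhysics.StatisticalMechanics

/-- **Glue, periodic half** (the chain of `Cruxes/HcpBulkFloor/Lines/birth.lean`, re-proved): stub (R)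
(item 3062 verbatim) → stub (S) (item 12054 verbatim) → `HcpDefectCounting.HcpPeriodicMinimiser`
(item 3061), through the landed items 3066, 3063, 3065, `energyPerParticle_hcp_eq` and
`tendsto_haggEnergy_div`. -/
theorem hcpPeriodicMinimiser_of_stubs :
    (∀ Q : Literature.MathematicalPhysics.StatisticalMechanics.PeriodicConfiguration 3, ∃ a h : ℝ, 47 / 50 ≤ a ∧ a ≤ 1 ∧ 39 / 50 * a ≤ h ∧ h ≤ 17 / 20 * a ∧ ∃ (s : ℤ → ℤ) (p : ℕ) (ha : a ≠ 0) (hh : h ≠ 0) (hp : p ≠ 0) (hs : ∀ i, s (i + p) = s i), Literature.MathematicalPhysics.StatisticalMechanics.IsHaggSeq s ∧ (Literature.MathematicalPhysics.StatisticalMechanics.barlowPeriodicConfiguration s ha hh hp hs).energyPerParticle Literature.MathematicalPhysics.StatisticalMechanics.lennardJones ≤ Q.energyPerParticle Literature.MathematicalPhysics.StatisticalMechanics.lennardJones) →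
    (∀ J : ℕ → ℝ, Summable (fun k : ℕ => (k : ℝ) * |J k|) → J 2 + ∑' k : ℕ, (if 3 ≤ k then ((k : ℝ) - 1) * |J k| else 0) ≤ 0 → IsLeast (Set.range fun s : {s : ℤ → ℤ // Literature.MathematicalPhysics.StatisticalMechanics.IsHaggSeq s} => Literature.MathematicalPhysics.StatisticalMechanics.haggStackingEnergy J s.1) (Literature.MathematicalPhysics.StatisticalMechanics.haggStackingEnergy J Literature.MathematicalPhysics.StatisticalMechanics.alternatingHagg)) →
    Summit.AtomisticToContinuum.Crystallization.Theses.HcpDefectCounting.HcpPeriodicMinimiser := by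
  intro hR hS
  obtain ⟨a₀, h₀, ha₀, hh₀, hb₁, hb₂, hb₃, hb₄, hmin⟩ :=
    Summit.AtomisticToContinuum.Crystallization.Theorems.PricedHcpWindowsHcpBox.stub_hcpEnergyMinOnBox
  refine ⟨a₀, h₀, ha₀, hh₀, hb₁, hb₂, hb₃, hb₄, ⟨hcpPeriodicConfiguration ha₀ hh₀, rfl⟩, ?_⟩
  rintro _ ⟨Q, rfl⟩
  obtain ⟨a, h, hc₁, hc₂, hc₃, hc₄, s, p, ha, hh, hp, hs, hHagg, hle⟩ := hR Q
  have ha0 : 0 < a := by linarith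
  have hh0 : 0 < h := by nlinarith
  have hp_pos : 0 < p := Nat.pos_of_ne_zero hp
  obtain ⟨hsum, hJ2, htail⟩ :=
    Summit.AtomisticToContinuum.Crystallization.Theorems.PricedHcpWindowsLjRegistry.stub_ljRegistryDomination
      a h hc₁ hc₂ hc₃ hc₄
  have hdomJ : barlowCoupling lennardJones a h 2 +
      ∑' k : ℕ, (if 3 ≤ k then ((k : ℝ) - 1) * |barlowCoupling lennardJones a h k| else 0) ≤ 0 := by
    have habs : |barlowCoupling lennardJones a h 2| = -barlowCoupling lennardJones a h 2 :=
      abs_of_neg hJ2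
    linarith
  have hsel : haggStackingEnergy (barlowCoupling lennardJones a h) alternatingHagg ≤
      haggStackingEnergy (barlowCoupling lennardJones a h) s :=
    (hS (barlowCoupling lennardJones a h) hsum hdomJ).2 ⟨⟨s, hHagg⟩, rfl⟩
  have hper : haggStackingEnergy (barlowCoupling lennardJones a h) s =
      haggEnergy p (barlowCoupling lennardJones a h) s / p := by
    unfold haggStackingEnergy
    exact (Summit.AtomisticToContinuum.Crystallization.Theorems.tendsto_haggEnergy_div hs _ hp_pos).liminf_eq
  have hdiv : (∑' k : ℕ, (if 2 ≤ k ∧ Even k then barlowCoupling lennardJones a h k else 0)) ≤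
      haggEnergy p (barlowCoupling lennardJones a h) s / p :=
    calc (∑' k : ℕ, (if 2 ≤ k ∧ Even k then barlowCoupling lennardJones a h k else 0))
          = haggStackingEnergy (barlowCoupling lennardJones a h) alternatingHagg :=
            (haggStackingEnergy_alternating _).symm
      _ ≤ haggStackingEnergy (barlowCoupling lennardJones a h) s := hsel
      _ = haggEnergy p (barlowCoupling lennardJones a h) s / p := hper
  have hEbar :=
    Summit.AtomisticToContinuum.Crystallization.Theorems.PricedHcpWindowsBarlowEnergy.stub_barlowEnergyIdentification
      a h ha0 hh0 s p ha hh hp hs hHagg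
  have hEhcp :=
    Summit.AtomisticToContinuum.Crystallization.Theorems.PricedHcpWindowsHcpBox.energyPerParticle_hcp_eq
      ha0 hh0 ha hh
  calc (hcpPeriodicConfiguration ha₀ hh₀).energyPerParticle lennardJones
        ≤ (hcpPeriodicConfiguration ha hh).energyPerParticle lennardJones :=
          hmin a h ha hh hc₁ hc₂ hc₃ hc₄
    _ = barlowBaseEnergy lennardJones a h +
          ∑' k : ℕ, (if 2 ≤ k ∧ Even k then barlowCoupling lennardJones a h k else 0) := hEhcp
    _ ≤ barlowBaseEnergy lennardJones a h + haggEnergy p (barlowCoupling lennardJones a h) s / p := by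
          linarith
    _ = (barlowPeriodicConfiguration s ha hh hp hs).energyPerParticle lennardJones := hEbar.symm
    _ ≤ Q.energyPerParticle lennardJones := hle

/-- **Glue, finite half** (`Cruxes/HcpBulkFloor/Lines/birth.lean`, re-proved): a box hcp that is a least
element of the periodic Lennard-Jones energies is a finite bulk floor — `N · e* ≤ 𝓔_LJ(x)` for injective
`x` is the landed `ChargedEnergyGapNegative.card_mul_eStar_le` (`e* = ⨅_Q e(Q)`), and `IsLeast.csInf_eq`
identifies `e*` with `e(hcp a h)`.  Injectivity of `x` is load-bearing (refuter's `Mutation.lean` on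
stmt-14477). -/
theorem hcpBulkFloor_of_hcpPeriodicMinimiser :
    Summit.AtomisticToContinuum.Crystallization.Theses.HcpDefectCounting.HcpPeriodicMinimiser →
    Summit.AtomisticToContinuum.Crystallization.Theses.HcpDefectCounting.HcpBulkFloor := by
  rintro ⟨a, h, ha, hh, hb₁, hb₂, hb₃, hb₄, hleast⟩
  refine ⟨a, h, ha, hh, hb₁, hb₂, hb₃, hb₄, fun N x hx => ?_⟩
  have hfloor :=
    Summit.AtomisticToContinuum.Crystallization.Theorems.ChargedEnergyGapNegative.card_mul_eStar_le hx
  have e : Summit.AtomisticToContinuum.Crystallization.Theorems.ChargedEnergyGapNegative.eStar =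
      (hcpPeriodicConfiguration ha hh).energyPerParticle lennardJones := hleast.csInf_eq
  rw [e] at hfloor
  exact hfloor

/-- **The reduction of skeleton v4, by name**: crux B `HullExactificationCascade.HcpLandscapeGap`
(stmt-12087) from the shared crux `PeriodicReductionToBarlow` (stmt-3062, hypothesis (R) verbatim), the
one-dimensional selection `DominatedRegistrySelectsHcp` (stmt-12054, hypothesis (S) verbatim) and the
sibling crux `HcpDefectCounting.HcpDefectCoercivity` (stmt-14476):
`(R) → (S) → HcpDefectCoercivity → HcpLandscapeGap`. -/
theorem HcpLandscapeGap_of_periodicReduction :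
    (∀ Q : Literature.MathematicalPhysics.StatisticalMechanics.PeriodicConfiguration 3, ∃ a h : ℝ, 47 / 50 ≤ a ∧ a ≤ 1 ∧ 39 / 50 * a ≤ h ∧ h ≤ 17 / 20 * a ∧ ∃ (s : ℤ → ℤ) (p : ℕ) (ha : a ≠ 0) (hh : h ≠ 0) (hp : p ≠ 0) (hs : ∀ i, s (i + p) = s i), Literature.MathematicalPhysics.StatisticalMechanics.IsHaggSeq s ∧ (Literature.MathematicalPhysics.StatisticalMechanics.barlowPeriodicConfiguration s ha hh hp hs).energyPerParticle Literature.MathematicalPhysics.StatisticalMechanics.lennardJones ≤ Q.energyPerParticle Literature.MathematicalPhysics.StatisticalMechanics.lennardJones) →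
    (∀ J : ℕ → ℝ, Summable (fun k : ℕ => (k : ℝ) * |J k|) → J 2 + ∑' k : ℕ, (if 3 ≤ k then ((k : ℝ) - 1) * |J k| else 0) ≤ 0 → IsLeast (Set.range fun s : {s : ℤ → ℤ // Literature.MathematicalPhysics.StatisticalMechanics.IsHaggSeq s} => Literature.MathematicalPhysics.StatisticalMechanics.haggStackingEnergy J s.1) (Literature.MathematicalPhysics.StatisticalMechanics.haggStackingEnergy J Literature.MathematicalPhysics.StatisticalMechanics.alternatingHagg)) →
    Summit.AtomisticToContinuum.Crystallization.Theses.HcpDefectCounting.HcpDefectCoercivity →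
    Summit.AtomisticToContinuum.Crystallization.Theses.HullExactificationCascade.HcpLandscapeGap :=
  fun hR hS hK => HcpLandscapeGap_of_hcpDefectCounting
    (hcpBulkFloor_of_hcpPeriodicMinimiser (hcpPeriodicMinimiser_of_stubs hR hS)) hK

/-- The same reduction routed through item 3061: `(R) → (S) → HcpDefectCoercivity → HcpLandscapeGap`
factors as `HcpPeriodicMinimiser → HcpDefectCoercivity → HcpLandscapeGap`. -/
theorem HcpLandscapeGap_of_hcpPeriodicMinimiser :
    Summit.AtomisticToContinuum.Crystallization.Theses.HcpDefectCounting.HcpPeriodicMinimiser →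
    Summit.AtomisticToContinuum.Crystallization.Theses.HcpDefectCounting.HcpDefectCoercivity →
    Summit.AtomisticToContinuum.Crystallization.Theses.HullExactificationCascade.HcpLandscapeGap :=
  fun hM hK => HcpLandscapeGap_of_hcpDefectCounting (hcpBulkFloor_of_hcpPeriodicMinimiser hM) hK

end Summit.AtomisticToContinuum.Crystallization.Theorems.HcpLandscapeGapBirth
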